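import Literature.Algebra.Lie.SkewAdjointToMatrixTransport
import Literature.Algebra.Lie.JordanLefschetzPairNeg
import Mathlib.LinearAlgebra.QuadraticForm.Dual
import HarnessLib

/-!
# Looijenga–Lunts (2.9), cases `(C_m, A_{m-1})` and `(D_{2m}, A_{2m-1})`, BASIS-FREE: a splitting `V = V_1 ⊕ V_{-1}` into totally isotropic subspaces grades `𝔰𝔭(V)` / `𝔰𝔬(V)` into a Jordan–Lefschetz pair

Topic `Literature/Algebra/Lie` (namespace `Literature.Algebra.Lie.LagrangianSplittingGrading`).  Lane `lit-hodgefound`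
(Track 2 foundations library), skeleton seat `lit-hodgefound-skel-1` (generation 51), row **A1-204** of
`run/shared/lean/pub/lit-hodgefound/SKELETON.md`.  Rows A1-190 (`𝔰𝔭_{2m}`, `h = diag(I, -I)`) and A1-192 (`typeD`,
`h = diag(I, -I)`) proved these gradings in split MATRIX coordinates and row A1-198 transports them to
`skewAdjointLieSubalgebra B` GIVEN an adapted basis.  This file removes the basis, exactly as (2.9) is printed and
over ANY field of characteristic `0`: for a non-degenerate alternating (resp. symmetric) form `B` on `V` and a
splitting `V = L ⊕ L'` into complementary totally isotropic subspaces (`L ≠ 0`, resp. `dim L = 2k`, `k ≥ 2`), the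
element `h ∈ 𝔰𝔭(V, B)` (resp. `𝔰𝔬(V, B)`) which is `+1` on `L` and `-1` on `L'` makes `(𝔰𝔭(V, B), h)` (resp.
`(𝔰𝔬(V, B), h)`) a Jordan–Lefschetz pair (`Literature.Algebra.Lie.IsJordanLefschetzPair`, row A1-84).  The proof is
the adapted basis: `B` pairs `L'` perfectly with `L` ("the obvious isomorphism `V_{-1} ≅ V_1^*`"), so a basis `(l_i)`
of `L` has a dual family `(l'_i)` in `L'`, `B(l'_i, l_j) = δ_{ij}`; `(l_i, l'_i)` is a basis of `V` with Gram matrix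
`J = (0 -I; I 0)` (alternating) resp. `JD = (0 I; I 0)` (symmetric) in which `h = diag(I, -I) = indefiniteDiagonal`,
and row A1-198 applies.  No algebraic closedness is needed (contrast row A1-203, where `V_0` had to be split).
THEOREMS ONLY (no definition, no named fact, no `sorry`; net debt `0`).

## Source, VERBATIM

E. Looijenga, V. A. Lunts, *A Lie algebra attached to a projective variety*, Invent. Math. **129** (1997) 361–412 (held
TeX `paper:arxiv-alg-geom_9604014`), (2.9) p. 10 L105–L110: "Case `(C_m, A_{m-1})`: `(𝔰𝔭(2m), 𝔰𝔩(m))` (`m ≥ 2`).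
Let `V` be a vector space of dimension `2m` equipped with a nondegenerate symplectic form and let `V = V_{-1} ⊕ V_1`
be a decomposition of `V` into totally isotropic subspaces of dimension `m`.  We take `𝔤 = 𝔰𝔭(V)` and let
`h ∈ 𝔰𝔭(V)` be the element with the eigen space decomposition `V_{-1} ⊕ V_1`.  Then `𝔤_0` maps isomorphically to
`𝔤𝔩(V_1)` …"; p. 11 L1–L6: "Case `(D_{2m}, A_{2m-1})`: `(𝔰𝔬(4m), 𝔰𝔩(2m))` (`m ≥ 2`).  Let `V` be a vector space of
dimension `4m` equipped with a nondegenerate symmetric bilinear form and let `V = V_{-1} ⊕ V_1` be a decomposition of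
`V` into totally isotropic subspaces of dimension `2m`.  We take `𝔤 = 𝔰𝔬(V)` and let `h ∈ 𝔰𝔬(V)` be the element
with the eigen space decomposition `V_{-1} ⊕ V_1`."; p. 11 L11–L12 ("the obvious isomorphism `V_{-1} ≅ V_1^*`");
(2.6) p. 10 L16–L31 (the list).

## Contents (all proved)

* §1 `projection_sub_projection_mem_skewAdjointLieSubalgebra` (`h = 1_L - 1_{L'} ∈ 𝔰𝔬/𝔰𝔭(V, B)` for `L, L'` totally
  isotropic, any `B`), `projection_sub_projection_apply`; `domRestrict₁₂_injective` (`L' ↪ L^*`);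
* §2 `finrank_eq_of_isCompl_isotropic` (`dim L = dim L'`), **`exists_basis_adapted_isotropic`** (a basis `(l_i)` of `L` extends
  by a dual family in `L'` to a basis of `V`);
* §3 **`isJordanLefschetzPair_lagrangianSplitting_symplectic`** (type `(C_m, A_{m-1})`), `…_mk`;
* §4 **`isJordanLefschetzPair_lagrangianSplitting_orthogonal`** (type `(D_{2m}, A_{2m-1})`, `dim L = 2k`, `k ≥ 2`),
  `…_mk`.
* §5 (rider, row A1-205) **(3.1) basis-free on Mathlib's carrier `V^* × V` with `LinearMap.dualProd`**:
  `dualProd_nondegenerate`, `prodMap_id_neg_id_mem_skewAdjointLieSubalgebra` (`u = id × (-id)`, i.e. LL's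
  `u = (-1_V, +1_{V^*})`), **`isJordanLefschetzPair_dualProd`** (`dim V = 2k`, `k ≥ 2`), `…_mk`, `…_neg` (the opposite
  sign, by row A1-202).  Source, VERBATIM, (3.1) p. 13 L43–L49: "The semi-simple element `u := (-1_V, +1_{V^*}) ∈
  𝔰𝔬(V ⊕ V^*)` defines a grading of the latter with degrees `2`, `0` and `-2`."
* §6–§7 (rider, row A1-206) **"Then `𝔤_0` maps isomorphically to `𝔤𝔩(V_1)`"** ((2.9) p. 10 L109–L110, p. 11 L5–L6),
  without naming the map: `mem_left_iff_apply_eq` / `mem_right_iff_apply_eq` (`L, L'` are the `±1`-eigenspaces of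
  `h`), `apply_mem_of_commute`, `mem_adDegree_zero_iff_commute`, `apply_mem_of_mem_adDegree_zero` (`𝔤_0` preserves
  `V_{±1}`), **`eq_zero_of_mem_adDegree_zero_of_forall_left`** (restriction to `V_1` is injective on `𝔤_0`),
  **`exists_mem_adDegree_zero_restrict_eq`** (every `A ∈ 𝔤𝔩(V_1)` is a restriction: `y = A ⊕ (-A^†)`, `A^†` the
  adjoint through `V_{-1} ≅ V_1^*`), **`existsUnique_mem_adDegree_zero_restrict_eq`** (`_of_isAlt`, `_of_isSymm`).
-/

namespace Literature.Algebra.Lie.LagrangianSplittingGrading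

open Module LieAlgebra LieAlgebra.Orthogonal LieAlgebra.Symplectic Matrix Sum Function Literature.Algebra.Lie

variable {K : Type*} [Field K] {V : Type*} [AddCommGroup V] [Module K V] {B : LinearMap.BilinForm K V}
  {L L' : Submodule K V}

/-! ### §1 The grading element `h = 1_L - 1_{L'}` of a splitting `V = L ⊕ L'` into totally isotropic subspaces -/

/-- `h = (+1 on L, -1 on L')` is skew-adjoint for ANY bilinear form for which `L` and `L'` are totally isotropic:
`B(hv, w) + B(v, hw) = 2B(v_L, w_L) - 2B(v_{L'}, w_{L'}) = 0`. [cite: LooijengaLunts1997, §2 (2.9) p. 10 L105–L110 ("let h ∈ 𝔰𝔭(V) be the element with the eigen space decomposition V_{-1} ⊕ V_1"), p. 11 L1–L6] -/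
theorem projection_sub_projection_mem_skewAdjointLieSubalgebra (hLL' : IsCompl L L')
    (hL : ∀ u ∈ L, ∀ v ∈ L, B u v = 0) (hL' : ∀ u ∈ L', ∀ v ∈ L', B u v = 0) :
    (L.projection L' hLL' - L'.projection L hLL'.symm : Module.End K V) ∈ skewAdjointLieSubalgebra B := by
  show (L.projection L' hLL' - L'.projection L hLL'.symm : Module.End K V) ∈ B.skewAdjointSubmodule
  rw [LinearMap.mem_skewAdjointSubmodule]
  intro v w
  have h11 : B (L.projection L' hLL' v) (L.projection L' hLL' w) = 0 :=
    hL _ (Submodule.projection_apply_mem hLL' v) _ (Submodule.projection_apply_mem hLL' w)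
  have h22 : B (L'.projection L hLL'.symm v) (L'.projection L hLL'.symm w) = 0 :=
    hL' _ (Submodule.projection_apply_mem hLL'.symm v) _ (Submodule.projection_apply_mem hLL'.symm w)
  rw [Pi.neg_apply, LinearMap.sub_apply, LinearMap.sub_apply]
  conv_lhs => rw [← Submodule.projection_add_projection_eq_self hLL' w]
  conv_rhs => rw [← Submodule.projection_add_projection_eq_self hLL' v]
  simp only [LinearMap.BilinForm.sub_left, LinearMap.BilinForm.add_right, LinearMap.BilinForm.add_left,
    LinearMap.BilinForm.neg_right, LinearMap.BilinForm.sub_right, h11, h22]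
  ring

/-- Its values: `+1` on `L`, `-1` on `L'`. [cite: LooijengaLunts1997, §2 (2.9) p. 10 L105–L110] -/
theorem projection_sub_projection_apply (hLL' : IsCompl L L') :
    (∀ v ∈ L, (L.projection L' hLL' - L'.projection L hLL'.symm : Module.End K V) v = v) ∧
      ∀ v ∈ L', (L.projection L' hLL' - L'.projection L hLL'.symm : Module.End K V) v = -v := by
  refine ⟨fun v hv ↦ ?_, fun v hv ↦ ?_⟩
  · rw [LinearMap.sub_apply, Submodule.projection_apply_of_mem_left hLL' hv,
      Submodule.projection_apply_of_mem_right hLL'.symm hv, sub_zero]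
  · rw [LinearMap.sub_apply, Submodule.projection_apply_of_mem_right hLL' hv,
      Submodule.projection_apply_of_mem_left hLL'.symm hv, zero_sub]

/-! ### §2 Complementary totally isotropic subspaces pair perfectly: the adapted basis -/

/-- For `V = P ⊕ Q` with `P` totally isotropic and `B` non-degenerate, `y ∈ P ↦ B(y, ·)|_Q` is injective. [cite: LooijengaLunts1997, §2 (2.9) p. 10 L105–L110, p. 11 L1–L6 ("the obvious isomorphism V_{-1} ≅ V_1^*")] -/
theorem domRestrict₁₂_injective (hB : B.Nondegenerate) {P Q : Submodule K V} (hPQ : IsCompl P Q)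
    (hP : ∀ u ∈ P, ∀ v ∈ P, B u v = 0) : Injective (B.domRestrict₁₂ P Q) := by
  rw [injective_iff_map_eq_zero]
  intro y hy
  have h0 : (y : V) = 0 := hB.1 y fun w ↦ by
    rw [← Submodule.projection_add_projection_eq_self hPQ w, map_add]
    have h1 : B y (P.projection Q hPQ w) = 0 := hP y y.2 _ (Submodule.projection_apply_mem hPQ w)
    have h2 : B y (Q.projection P hPQ.symm w) = 0 := by
      have := LinearMap.congr_fun hy ⟨_, Submodule.projection_apply_mem hPQ.symm w⟩
      simpa only [LinearMap.domRestrict₁₂_apply, LinearMap.zero_apply] using this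
    rw [h1, h2, add_zero]
  exact Subtype.ext h0

section Adapted

variable [FiniteDimensional K V]

/-- Hence `dim P = dim Q` ("totally isotropic subspaces of dimension `m`" is automatic). [cite: LooijengaLunts1997, §2 (2.9) p. 10 L105–L110] -/
theorem finrank_eq_of_isCompl_isotropic (hB : B.Nondegenerate) (hLL' : IsCompl L L')
    (hL : ∀ u ∈ L, ∀ v ∈ L, B u v = 0) (hL' : ∀ u ∈ L', ∀ v ∈ L', B u v = 0) :
    finrank K L = finrank K L' := by
  have h1 := LinearMap.finrank_le_finrank_of_injective (domRestrict₁₂_injective hB hLL' hL)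
  have h2 := LinearMap.finrank_le_finrank_of_injective (domRestrict₁₂_injective hB hLL'.symm hL')
  rw [Subspace.dual_finrank_eq] at h1 h2
  exact le_antisymm h1 h2

/-- **The adapted basis.**  For `V = L ⊕ L'` with `L, L'` totally isotropic and `B` non-degenerate, every basis `(l_i)`
of `L` extends by vectors `l'_i ∈ L'` with `B(l'_i, l_j) = δ_{ij}` to a basis of `V` (the dual basis through
`L' ≅ L^*`). [cite: LooijengaLunts1997, §2 (2.9) p. 10 L105–L110, p. 11 L1–L6 ("the obvious isomorphism V_{-1} ≅ V_1^*")] -/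
theorem exists_basis_adapted_isotropic (hB : B.Nondegenerate) (hLL' : IsCompl L L') (hL : ∀ u ∈ L, ∀ v ∈ L, B u v = 0)
    (hL' : ∀ u ∈ L', ∀ v ∈ L', B u v = 0) {ι : Type*} [Fintype ι] [DecidableEq ι] (bL : Basis ι K L) :
    ∃ b : Basis (ι ⊕ ι) K V, (∀ i, b (inl i) = bL i) ∧ (∀ i, b (inr i) ∈ L') ∧
      ∀ i j, B (b (inr i)) (b (inl j)) = if i = j then 1 else 0 := by
  classical
  -- `L' ≅ L^*`
  let φ : L' →ₗ[K] Module.Dual K L := B.domRestrict₁₂ L' L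
  have hφi : Injective φ := domRestrict₁₂_injective hB hLL'.symm hL'
  have hφs : Surjective φ := by
    refine (LinearMap.injective_iff_surjective_of_finrank_eq_finrank ?_).1 hφi
    rw [Subspace.dual_finrank_eq, finrank_eq_of_isCompl_isotropic hB hLL' hL hL']
  let e : L' ≃ₗ[K] Module.Dual K L := LinearEquiv.ofBijective φ ⟨hφi, hφs⟩
  let c : ι → L' := fun i ↦ e.symm (bL.dualBasis i)
  have hc : ∀ i j, B (c i : V) (bL j) = if i = j then 1 else 0 := fun i j ↦ by
    have h1 : φ (c i) (bL j) = B (c i : V) (bL j) := by rw [LinearMap.domRestrict₁₂_apply]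
    rw [← h1, show φ (c i) = e (c i) from rfl, LinearEquiv.apply_symm_apply, Basis.dualBasis_apply_self]
    by_cases hij : i = j
    · subst hij; simp
    · simp [hij, Ne.symm hij]
  -- the family
  let v : ι ⊕ ι → V := Sum.elim (fun i ↦ (bL i : V)) (fun i ↦ (c i : V))
  have hli : LinearIndependent K v := by
    rw [Fintype.linearIndependent_iff]
    intro g hg q
    rcases q with i | i
    · -- pair on the left with `c i`
      have h1 := congrArg (fun w ↦ B (c i : V) w) hg
      simp only [LinearMap.BilinForm.add_right, LinearMap.BilinForm.sum_right, LinearMap.BilinForm.smul_right,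
        Fintype.sum_sum_type, v, Sum.elim_inl, Sum.elim_inr, hc, mul_ite, mul_one, mul_zero, Finset.sum_ite_eq,
        Finset.mem_univ, if_true, hL' (c i : V) (c i).2 (c _ : V) (c _).2, Finset.sum_const_zero, add_zero,
        LinearMap.BilinForm.zero_right] at h1
      exact h1
    · -- pair on the right with `l_i`
      have h1 := congrArg (fun w ↦ B w (bL i : V)) hg
      simp only [LinearMap.BilinForm.add_left, LinearMap.BilinForm.sum_left, LinearMap.BilinForm.smul_left,
        Fintype.sum_sum_type, v, Sum.elim_inl, Sum.elim_inr, hc, mul_ite, mul_one, mul_zero, Finset.sum_ite_eq',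
        Finset.mem_univ, if_true, hL (bL _ : V) (bL _).2 (bL i : V) (bL i).2, Finset.sum_const_zero, zero_add,
        LinearMap.BilinForm.zero_left] at h1
      exact h1
  have hcard : Fintype.card (ι ⊕ ι) = finrank K V := by
    rw [Fintype.card_sum, ← Submodule.finrank_add_eq_of_isCompl hLL', ← finrank_eq_of_isCompl_isotropic hB hLL' hL hL',
      finrank_eq_card_basis bL]
  have hspan : ⊤ ≤ Submodule.span K (Set.range v) := (hli.span_eq_top_of_card_eq_finrank' hcard).ge
  refine ⟨Basis.mk hli hspan, fun i ↦ by rw [Basis.mk_apply]; rfl, fun i ↦ by rw [Basis.mk_apply]; exact (c i).2,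
    fun i j ↦ by rw [Basis.mk_apply, Basis.mk_apply]; exact hc i j⟩

end Adapted

/-! ### §3 (2.9) Case `(C_m, A_{m-1})`, basis-free: `V` symplectic, `V = V_1 ⊕ V_{-1}` Lagrangian -/

section Symplectic

variable [CharZero K] [FiniteDimensional K V]

/-- **(2.9), Case `(C_m, A_{m-1})`, AS PRINTED (basis-free, any field of characteristic `0`)**: "Let `V` be a vector
space of dimension `2m` equipped with a nondegenerate symplectic form and let `V = V_{-1} ⊕ V_1` be a decomposition of
`V` into totally isotropic subspaces of dimension `m`.  We take `𝔤 = 𝔰𝔭(V)` and let `h ∈ 𝔰𝔭(V)` be the element with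
the eigen space decomposition `V_{-1} ⊕ V_1`."  Then `(𝔰𝔭(V), h)` is a Jordan–Lefschetz pair: an adapted basis
(`l_i` of `V_1 = L`, dual `l'_i ∈ V_{-1} = L'`) has Gram matrix `J = (0 -I; I 0)` and `h = diag(I, -I)`, so row A1-198
transports row A1-190. [cite: LooijengaLunts1997, §2 (2.9) p. 10 L105–L110, p. 11 L1–L6; (2.6) p. 10 L16–L31 ("(C_l, α_l)")] -/
theorem isJordanLefschetzPair_lagrangianSplitting_symplectic (hB : B.Nondegenerate) (halt : B.IsAlt)
    (hLL' : IsCompl L L') (hL : ∀ u ∈ L, ∀ v ∈ L, B u v = 0) (hL' : ∀ u ∈ L', ∀ v ∈ L', B u v = 0) (hL0 : L ≠ ⊥)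
    (x : skewAdjointLieSubalgebra B) (hxL : ∀ v ∈ L, (x : Module.End K V) v = v)
    (hxL' : ∀ v ∈ L', (x : Module.End K V) v = -v) : IsJordanLefschetzPair K x := by
  classical
  set n := finrank K L with hn
  let bL : Basis (Fin n) K L := Module.finBasisOfFinrankEq K L hn.symm
  haveI : Nonempty (Fin n) := by
    refine ⟨⟨0, Nat.pos_of_ne_zero fun h0 ↦ hL0 ?_⟩⟩
    rw [← Submodule.finrank_eq_zero, ← hn, h0]
  obtain ⟨b, hbl, hbr, hB'⟩ := exists_basis_adapted_isotropic hB hLL' hL hL' bL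
  -- Gram matrix `J`
  have hGram : LinearMap.BilinForm.toMatrix b B = J (Fin n) K := by
    ext p q
    rw [LinearMap.BilinForm.toMatrix_apply]
    rcases p with i | i <;> rcases q with j | j
    · rw [hbl, hbl]; simp [J, hL (bL i : V) (bL i).2 (bL j : V) (bL j).2]
    · rw [← halt.neg_eq, hB']; simp [J, Matrix.one_apply, eq_comm]
    · rw [hB']; simp [J, Matrix.one_apply]
    · simp [J, hL' _ (hbr i) _ (hbr j)]
  -- matrix of `h`
  have hxmat : LinearMap.toMatrix b b (x : Module.End K V) = indefiniteDiagonal (Fin n) (Fin n) K := by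
    ext p q
    rw [LinearMap.toMatrix_apply]
    rcases q with j | j
    · rw [hxL _ (by rw [hbl]; exact (bL j).2), b.repr_self]
      rcases p with i | i <;> simp [indefiniteDiagonal, Matrix.diagonal_apply, Finsupp.single_apply, eq_comm]
    · rw [hxL' _ (hbr j), map_neg, b.repr_self]
      rcases p with i | i <;> simp [indefiniteDiagonal, Matrix.diagonal_apply, Finsupp.single_apply, eq_comm]
      split_ifs <;> simp
  exact SkewAdjointToMatrixTransport.isJordanLefschetzPair_skewAdjoint_of_toMatrix_eq_J b B hGram x hxmat

/-- The same with `h` the explicit element `1_L - 1_{L'}`. [cite: LooijengaLunts1997, §2 (2.9) p. 10 L105–L110] -/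
theorem isJordanLefschetzPair_lagrangianSplitting_symplectic_mk (hB : B.Nondegenerate) (halt : B.IsAlt)
    (hLL' : IsCompl L L') (hL : ∀ u ∈ L, ∀ v ∈ L, B u v = 0) (hL' : ∀ u ∈ L', ∀ v ∈ L', B u v = 0) (hL0 : L ≠ ⊥) :
    IsJordanLefschetzPair K (⟨L.projection L' hLL' - L'.projection L hLL'.symm,
      projection_sub_projection_mem_skewAdjointLieSubalgebra hLL' hL hL'⟩ : skewAdjointLieSubalgebra B) :=
  isJordanLefschetzPair_lagrangianSplitting_symplectic hB halt hLL' hL hL' hL0 _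
    (projection_sub_projection_apply hLL').1 (projection_sub_projection_apply hLL').2

end Symplectic

/-! ### §4 (2.9) Case `(D_{2m}, A_{2m-1})`, basis-free: `V` quadratic of dimension `4m ≥ 8`, `V = V_1 ⊕ V_{-1}` totally isotropic -/

section Orthogonal

variable [CharZero K] [FiniteDimensional K V]

/-- **(2.9), Case `(D_{2m}, A_{2m-1})`, AS PRINTED (basis-free, any field of characteristic `0`)**: "Let `V` be a
vector space of dimension `4m` equipped with a nondegenerate symmetric bilinear form and let `V = V_{-1} ⊕ V_1` be a
decomposition of `V` into totally isotropic subspaces of dimension `2m`.  We take `𝔤 = 𝔰𝔬(V)` and let `h ∈ 𝔰𝔬(V)` be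
the element with the eigen space decomposition `V_{-1} ⊕ V_1`" (`m ≥ 2`).  Then `(𝔰𝔬(V), h)` is a Jordan–Lefschetz
pair: an adapted basis has Gram matrix `JD = (0 I; I 0)` and `h = diag(I, -I)`, so row A1-198 transports row A1-192.
[cite: LooijengaLunts1997, §2 (2.9) p. 11 L1–L6; (2.6) p. 10 L16–L31 ("(D_l, α_{l-1}), (D_l, α_l)")] -/
theorem isJordanLefschetzPair_lagrangianSplitting_orthogonal (hB : B.Nondegenerate) (hs : ∀ u v : V, B u v = B v u)
    (hLL' : IsCompl L L') (hL : ∀ u ∈ L, ∀ v ∈ L, B u v = 0) (hL' : ∀ u ∈ L', ∀ v ∈ L', B u v = 0)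
    {k : ℕ} (hk : finrank K L = k + k) (h2k : 2 ≤ k)
    (x : skewAdjointLieSubalgebra B) (hxL : ∀ v ∈ L, (x : Module.End K V) v = v)
    (hxL' : ∀ v ∈ L', (x : Module.End K V) v = -v) : IsJordanLefschetzPair K x := by
  classical
  let bL : Basis (Fin k ⊕ Fin k) K L := (Module.finBasisOfFinrankEq K L hk).reindex finSumFinEquiv.symm
  obtain ⟨b, hbl, hbr, hB'⟩ := exists_basis_adapted_isotropic hB hLL' hL hL' bL
  -- Gram matrix `JD`
  have hGram : LinearMap.BilinForm.toMatrix b B = JD (Fin k ⊕ Fin k) K := by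
    ext p q
    rw [LinearMap.BilinForm.toMatrix_apply]
    rcases p with i | i <;> rcases q with j | j
    · rw [hbl, hbl]; simp [JD, hL (bL i : V) (bL i).2 (bL j : V) (bL j).2]
    · rw [hs, hB']; simp [JD, Matrix.one_apply, eq_comm]
    · rw [hB']; simp [JD, Matrix.one_apply]
    · simp [JD, hL' _ (hbr i) _ (hbr j)]
  -- matrix of `h`
  have hxmat : LinearMap.toMatrix b b (x : Module.End K V) = indefiniteDiagonal (Fin k ⊕ Fin k) (Fin k ⊕ Fin k) K := by
    ext p q
    rw [LinearMap.toMatrix_apply]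
    rcases q with j | j
    · rw [hxL _ (by rw [hbl]; exact (bL j).2), b.repr_self]
      rcases p with i | i <;> simp [indefiniteDiagonal, Matrix.diagonal_apply, Finsupp.single_apply, eq_comm]
    · rw [hxL' _ (hbr j), map_neg, b.repr_self]
      rcases p with i | i <;> simp [indefiniteDiagonal, Matrix.diagonal_apply, Finsupp.single_apply, eq_comm]
      split_ifs <;> simp
  have hl : 2 ≤ Fintype.card (Fin k) := by rwa [Fintype.card_fin]
  exact SkewAdjointToMatrixTransport.isJordanLefschetzPair_skewAdjoint_of_toMatrix_eq_JD_indefiniteDiagonal b B hGram hl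
    x hxmat

/-- The same with `h` the explicit element `1_L - 1_{L'}`. [cite: LooijengaLunts1997, §2 (2.9) p. 11 L1–L6] -/
theorem isJordanLefschetzPair_lagrangianSplitting_orthogonal_mk (hB : B.Nondegenerate)
    (hs : ∀ u v : V, B u v = B v u) (hLL' : IsCompl L L') (hL : ∀ u ∈ L, ∀ v ∈ L, B u v = 0)
    (hL' : ∀ u ∈ L', ∀ v ∈ L', B u v = 0) {k : ℕ} (hk : finrank K L = k + k) (h2k : 2 ≤ k) :
    IsJordanLefschetzPair K (⟨L.projection L' hLL' - L'.projection L hLL'.symm,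
      projection_sub_projection_mem_skewAdjointLieSubalgebra hLL' hL hL'⟩ : skewAdjointLieSubalgebra B) :=
  isJordanLefschetzPair_lagrangianSplitting_orthogonal hB hs hLL' hL hL' hk h2k _
    (projection_sub_projection_apply hLL').1 (projection_sub_projection_apply hLL').2

end Orthogonal

/-! ### §5 (3.1), basis-free: `u = (+1_{V^*}, -1_V)` on `V^* ⊕ V` with its canonical split form (rider, row A1-205) -/

section DualProd

variable {M : Type*} [AddCommGroup M] [Module K M]

/-- `u = (+1_{V^*}, -1_V)` is skew-adjoint for the split form. [cite: LooijengaLunts1997, §3 (3.1) p. 13 L43–L49 ("The semi-simple element u := (-1_V, +1_{V^*}) ∈ 𝔰𝔬(V ⊕ V^*)")] -/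
theorem prodMap_id_neg_id_mem_skewAdjointLieSubalgebra :
    (LinearMap.id.prodMap (-LinearMap.id) : Module.End K (Module.Dual K M × M)) ∈
      skewAdjointLieSubalgebra (LinearMap.dualProd K M) := by
  show (LinearMap.id.prodMap (-LinearMap.id) : Module.End K (Module.Dual K M × M)) ∈
    (LinearMap.dualProd K M).skewAdjointSubmodule
  rw [LinearMap.mem_skewAdjointSubmodule]
  rintro ⟨f, v⟩ ⟨g, w⟩
  simp only [Pi.neg_apply, LinearMap.prodMap_apply, LinearMap.id_apply, LinearMap.neg_apply, Prod.neg_mk, neg_neg,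
    LinearMap.dualProd_apply_apply, map_neg, LinearMap.neg_apply]

variable [FiniteDimensional K M]

/-- Mathlib's split form `⟨(f, x), (g, y)⟩ = f y + g x` on `V^* × V` is non-degenerate (finite dimension). [cite: LooijengaLunts1997, §3 (3.1) p. 13 L43–L49, (3.3) p. 13] -/
theorem dualProd_nondegenerate : (LinearMap.dualProd K M).Nondegenerate := by
  rw [LinearMap.BilinForm.Nondegenerate, (LinearMap.isSymm_dualProd K M).isRefl.nondegenerate_iff_separatingLeft]
  exact (LinearMap.separatingLeft_dualProd K M).2 (Module.bijective_dual_eval K M).1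

variable [CharZero K]

/-- **(3.1), AS PRINTED, basis-free**: "The semi-simple element `u := (-1_V, +1_{V^*}) ∈ 𝔰𝔬(V ⊕ V^*)` defines a
grading of the latter with degrees `2`, `0` and `-2`"; for `dim V = 2k`, `k ≥ 2`, `(𝔰𝔬(V^* ⊕ V), u)` is a
Jordan–Lefschetz pair (type `(D_{2k}, A_{2k-1})`: `V^*` and `V` are complementary totally isotropic subspaces for
the split form — §4 with `L = V^* × 0`, `L' = 0 × V`). [cite: LooijengaLunts1997, §3 (3.1) p. 13 L43–L49; §2 (2.9) p. 11 L1–L6] -/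
theorem isJordanLefschetzPair_dualProd {k : ℕ} (hk : finrank K M = k + k) (h2k : 2 ≤ k)
    (x : skewAdjointLieSubalgebra (LinearMap.dualProd K M))
    (hx : ∀ (f : Module.Dual K M) (v : M), (x : Module.End K (Module.Dual K M × M)) (f, v) = (f, -v)) :
    IsJordanLefschetzPair K x := by
  have hL : ∀ u ∈ LinearMap.range (LinearMap.inl K (Module.Dual K M) M),
      ∀ v ∈ LinearMap.range (LinearMap.inl K (Module.Dual K M) M), LinearMap.dualProd K M u v = 0 := by
    rintro _ ⟨f, rfl⟩ _ ⟨g, rfl⟩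
    simp only [LinearMap.inl_apply, LinearMap.dualProd_apply_apply, map_zero, add_zero]
  have hL' : ∀ u ∈ LinearMap.range (LinearMap.inr K (Module.Dual K M) M),
      ∀ v ∈ LinearMap.range (LinearMap.inr K (Module.Dual K M) M), LinearMap.dualProd K M u v = 0 := by
    rintro _ ⟨f, rfl⟩ _ ⟨g, rfl⟩
    simp only [LinearMap.inr_apply, LinearMap.dualProd_apply_apply, LinearMap.zero_apply, add_zero]
  have hdim : finrank K (LinearMap.range (LinearMap.inl K (Module.Dual K M) M)) = k + k := by
    rw [LinearMap.finrank_range_of_inj LinearMap.inl_injective, Subspace.dual_finrank_eq, hk]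
  refine isJordanLefschetzPair_lagrangianSplitting_orthogonal (dualProd_nondegenerate)
    (fun u v ↦ (LinearMap.isSymm_dualProd K M).eq u v) LinearMap.isCompl_range_inl_inr hL hL' hdim h2k x ?_ ?_
  · rintro _ ⟨f, rfl⟩
    rw [LinearMap.inl_apply, hx, neg_zero]
  · rintro _ ⟨v, rfl⟩
    rw [LinearMap.inr_apply, hx, Prod.neg_mk, neg_zero]

/-- The same for the explicit element `u = id × (-id)`. [cite: LooijengaLunts1997, §3 (3.1) p. 13 L43–L49] -/
theorem isJordanLefschetzPair_dualProd_mk {k : ℕ} (hk : finrank K M = k + k) (h2k : 2 ≤ k) :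
    IsJordanLefschetzPair K (⟨LinearMap.id.prodMap (-LinearMap.id), prodMap_id_neg_id_mem_skewAdjointLieSubalgebra⟩ :
      skewAdjointLieSubalgebra (LinearMap.dualProd K M)) :=
  isJordanLefschetzPair_dualProd hk h2k _ fun f v ↦ by
    simp only [LinearMap.prodMap_apply, LinearMap.id_apply, LinearMap.neg_apply]

/-- And LL's own sign `u = (-1_V, +1_{V^*})` written on `V^* × V` as `(-id) × id`... no: LL's `u` is `-1` on `V` and
`+1` on `V^*`, which on Mathlib's carrier `V^* × V` IS `id × (-id)` above; the opposite element `(-id) × id = -u`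
is Jordan–Lefschetz as well (row A1-202 `IsJordanLefschetzPair.neg`). [cite: LooijengaLunts1997, §3 (3.1) p. 13 L43–L49] -/
theorem isJordanLefschetzPair_dualProd_neg {k : ℕ} (hk : finrank K M = k + k) (h2k : 2 ≤ k)
    (x : skewAdjointLieSubalgebra (LinearMap.dualProd K M))
    (hx : ∀ (f : Module.Dual K M) (v : M), (x : Module.End K (Module.Dual K M × M)) (f, v) = (-f, v)) :
    IsJordanLefschetzPair K x := by
  have h := (isJordanLefschetzPair_dualProd hk h2k (-x) fun f v ↦ by
    rw [show ((-x : skewAdjointLieSubalgebra (LinearMap.dualProd K M)) : Module.End K (Module.Dual K M × M)) =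
        -(x : Module.End K (Module.Dual K M × M)) from rfl, LinearMap.neg_apply, hx, Prod.neg_mk, neg_neg]).neg
  rwa [neg_neg] at h

end DualProd

/-! ### §6 The eigenspaces of `h = 1_L - 1_{L'}` are `L` and `L'` (rider, row A1-206) -/

section Eigen

variable [CharZero K]

/-- `L = ker (h - 1)`. [cite: LooijengaLunts1997, §2 (2.9) p. 10 L105–L110 ("the element with the eigen space decomposition V_{-1} ⊕ V_1")] -/
theorem mem_left_iff_apply_eq (hLL' : IsCompl L L') (x : Module.End K V) (hxL : ∀ v ∈ L, x v = v)
    (hxL' : ∀ v ∈ L', x v = -v) (v : V) : v ∈ L ↔ x v = v := by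
  refine ⟨hxL v, fun hv ↦ ?_⟩
  have hdec := Submodule.projection_add_projection_eq_self hLL' v
  set v₁ := L.projection L' hLL' v
  set v₂ := L'.projection L hLL'.symm v
  have h1 : x v₁ = v₁ := hxL _ (Submodule.projection_apply_mem hLL' v)
  have h2 : x v₂ = -v₂ := hxL' _ (Submodule.projection_apply_mem hLL'.symm v)
  have h3 : (2 : K) • v₂ = 0 := by
    rw [← hdec, map_add, h1, h2] at hv
    rw [two_smul]
    have := sub_eq_zero.2 hv
    rw [show v₁ + -v₂ - (v₁ + v₂) = -(v₂ + v₂) from by abel, neg_eq_zero] at this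
    exact this
  rw [smul_eq_zero, or_iff_right (two_ne_zero' K)] at h3
  rw [← hdec, h3, add_zero]
  exact Submodule.projection_apply_mem hLL' v

/-- `L' = ker (h + 1)`. [cite: LooijengaLunts1997, §2 (2.9) p. 10 L105–L110] -/
theorem mem_right_iff_apply_eq (hLL' : IsCompl L L') (x : Module.End K V) (hxL : ∀ v ∈ L, x v = v)
    (hxL' : ∀ v ∈ L', x v = -v) (v : V) : v ∈ L' ↔ x v = -v := by
  refine ⟨hxL' v, fun hv ↦ ?_⟩
  have h := (mem_left_iff_apply_eq hLL'.symm (-x) (fun w hw ↦ by rw [LinearMap.neg_apply, hxL' w hw, neg_neg])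
    (fun w hw ↦ by rw [LinearMap.neg_apply, hxL w hw]) v).2
  exact h (by rw [LinearMap.neg_apply, hv, neg_neg])

/-- An endomorphism commuting with `h` preserves `L` and `L'`. [cite: LooijengaLunts1997, §2 (2.9) p. 10 L105–L110 ("Then 𝔤_0 maps isomorphically to 𝔤𝔩(V_1)")] -/
theorem apply_mem_of_commute (hLL' : IsCompl L L') (x : Module.End K V) (hxL : ∀ v ∈ L, x v = v)
    (hxL' : ∀ v ∈ L', x v = -v) (y : Module.End K V) (hc : ∀ v, x (y v) = y (x v)) :
    (∀ v ∈ L, y v ∈ L) ∧ ∀ v ∈ L', y v ∈ L' := by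
  refine ⟨fun v hv ↦ ?_, fun v hv ↦ ?_⟩
  · rw [mem_left_iff_apply_eq hLL' x hxL hxL', hc, hxL v hv]
  · rw [mem_right_iff_apply_eq hLL' x hxL hxL', hc, hxL' v hv, map_neg]

end Eigen

/-! ### §7 `𝔤_0 → 𝔤𝔩(V_1)` is injective and surjective ("`𝔤_0` maps isomorphically to `𝔤𝔩(V_1)`"; rider, row A1-206) -/

/-- For `x y ∈ 𝔰𝔬/𝔰𝔭(V, B)`: `y ∈ 𝔤_0(x)` iff `x, y` commute on `V`. [cite: LooijengaLunts1997, §1 p0004 L94–L105 (𝔤_k = ker(ad h - k))] -/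
theorem mem_adDegree_zero_iff_commute (x y : skewAdjointLieSubalgebra B) :
    y ∈ adDegree K x 0 ↔ ∀ v, (x : Module.End K V) ((y : Module.End K V) v) = (y : Module.End K V) ((x : Module.End K V) v) := by
  letI : LieRing (Module.End K V) := LieRing.ofAssociativeRing
  rw [mem_adDegree_iff, zero_smul, Subtype.ext_iff, LieSubalgebra.coe_bracket, ZeroMemClass.coe_zero, Ring.lie_def,
    sub_eq_zero, LinearMap.ext_iff]
  simp only [Module.End.mul_apply]

section Faithful

variable [CharZero K]

/-- **`𝔤_0 → 𝔤𝔩(V_1)` is injective**: an element of `𝔤_0` vanishing on `L = V_1` vanishes (its values on `L'` lie in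
`L'`, are `B`-orthogonal to `L` by skewness and to `L'` by isotropy). [cite: LooijengaLunts1997, §2 (2.9) p. 10 L105–L110 ("Then 𝔤_0 maps isomorphically to 𝔤𝔩(V_1)"), p. 11 L1–L6] -/
theorem eq_zero_of_mem_adDegree_zero_of_forall_left (hB : B.Nondegenerate) (hLL' : IsCompl L L')
    (hL' : ∀ u ∈ L', ∀ v ∈ L', B u v = 0) (x : skewAdjointLieSubalgebra B) (hxL : ∀ v ∈ L, (x : Module.End K V) v = v)
    (hxL' : ∀ v ∈ L', (x : Module.End K V) v = -v) (y : skewAdjointLieSubalgebra B) (hy : y ∈ adDegree K x 0)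
    (hy0 : ∀ v ∈ L, (y : Module.End K V) v = 0) : y = 0 := by
  rw [mem_adDegree_zero_iff_commute] at hy
  have hpres := apply_mem_of_commute hLL' (x : Module.End K V) hxL hxL' (y : Module.End K V) hy
  have hskew : ∀ a b, B ((y : Module.End K V) a) b = -B a ((y : Module.End K V) b) := fun a b ↦ by
    have h := (LinearMap.mem_skewAdjointSubmodule (y : Module.End K V)).1 y.2 a b
    rwa [Pi.neg_apply, LinearMap.BilinForm.neg_right] at h
  apply Subtype.ext
  ext v
  rw [ZeroMemClass.coe_zero, LinearMap.zero_apply, ← Submodule.projection_add_projection_eq_self hLL' v, map_add,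
    hy0 _ (Submodule.projection_apply_mem hLL' v), zero_add]
  set v₂ := L'.projection L hLL'.symm v
  have hv₂ : v₂ ∈ L' := Submodule.projection_apply_mem hLL'.symm v
  refine hB.1 _ fun w ↦ ?_
  rw [← Submodule.projection_add_projection_eq_self hLL' w, map_add, hskew v₂ (L.projection L' hLL' w),
    hy0 _ (Submodule.projection_apply_mem hLL' w), LinearMap.BilinForm.zero_right, neg_zero, zero_add]
  exact hL' _ (hpres.2 v₂ hv₂) _ (Submodule.projection_apply_mem hLL'.symm w)

/-- And elements of `𝔤_0` preserve `V_1` and `V_{-1}` (so "restriction to `V_1`" makes sense). [cite: LooijengaLunts1997, §2 (2.9) p. 10 L105–L110] -/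
theorem apply_mem_of_mem_adDegree_zero (hLL' : IsCompl L L') (x : skewAdjointLieSubalgebra B)
    (hxL : ∀ v ∈ L, (x : Module.End K V) v = v) (hxL' : ∀ v ∈ L', (x : Module.End K V) v = -v)
    (y : skewAdjointLieSubalgebra B) (hy : y ∈ adDegree K x 0) :
    (∀ v ∈ L, (y : Module.End K V) v ∈ L) ∧ ∀ v ∈ L', (y : Module.End K V) v ∈ L' :=
  apply_mem_of_commute hLL' (x : Module.End K V) hxL hxL' (y : Module.End K V) ((mem_adDegree_zero_iff_commute x y).1 hy)

end Faithful

section Surjective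

variable [FiniteDimensional K V]

/-- **`𝔤_0 → 𝔤𝔩(V_1)` is surjective**: every `A ∈ 𝔤𝔩(L)` extends to `y = A ⊕ (-A^†) ∈ 𝔤_0`, where
`A^† ∈ 𝔤𝔩(L')` is the adjoint through the perfect pairing `L' ≅ L^*` (`B(A^† l', l) = B(l', A l)`); here `B` is
`ε`-symmetric (`ε = ±1`: orthogonal / symplectic). [cite: LooijengaLunts1997, §2 (2.9) p. 10 L105–L110 ("Then 𝔤_0 maps isomorphically to 𝔤𝔩(V_1)"), p. 11 L1–L6, L11–L12 ("the obvious isomorphism V_{-1} ≅ V_1^*")] -/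
theorem exists_mem_adDegree_zero_restrict_eq (hB : B.Nondegenerate) {ε : K} (hε : ∀ u v, B u v = ε * B v u)
    (hLL' : IsCompl L L') (hL : ∀ u ∈ L, ∀ v ∈ L, B u v = 0)
    (hL' : ∀ u ∈ L', ∀ v ∈ L', B u v = 0) (x : skewAdjointLieSubalgebra B) (hxL : ∀ v ∈ L, (x : Module.End K V) v = v)
    (hxL' : ∀ v ∈ L', (x : Module.End K V) v = -v) (A : L →ₗ[K] L) :
    ∃ y : skewAdjointLieSubalgebra B, y ∈ adDegree K x 0 ∧ ∀ v : L, (y : Module.End K V) v = A v := by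
  classical
  -- the perfect pairing `L' ≅ L^*`
  let φ : L' →ₗ[K] Module.Dual K L := B.domRestrict₁₂ L' L
  have hφi : Injective φ := domRestrict₁₂_injective hB hLL'.symm hL'
  have hφs : Surjective φ := by
    refine (LinearMap.injective_iff_surjective_of_finrank_eq_finrank ?_).1 hφi
    rw [Subspace.dual_finrank_eq, finrank_eq_of_isCompl_isotropic hB hLL' hL hL']
  let e : L' ≃ₗ[K] Module.Dual K L := LinearEquiv.ofBijective φ ⟨hφi, hφs⟩
  -- the adjoint `A^†`
  let A' : L' →ₗ[K] L' := e.symm.toLinearMap ∘ₗ A.dualMap ∘ₗ e.toLinearMap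
  have hA' : ∀ (l' : L') (l : L), B (A' l' : V) l = B (l' : V) (A l) := fun l' l ↦ by
    have h1 : ∀ (m : L') (l : L), B (m : V) l = e m l := fun m l ↦ by
      rw [show e m = φ m from rfl, LinearMap.domRestrict₁₂_apply]
    rw [h1, h1, show A' l' = e.symm (A.dualMap (e l')) from rfl, LinearEquiv.apply_symm_apply, LinearMap.dualMap_apply]
  -- the extension `y = A P_L - A^† P_{L'}`
  let P : V →ₗ[K] L := L.projectionOnto L' hLL'
  let P' : V →ₗ[K] L' := L'.projectionOnto L hLL'.symm
  let y : Module.End K V := L.subtype ∘ₗ A ∘ₗ P - L'.subtype ∘ₗ A' ∘ₗ P'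
  have hyapp : ∀ v, y v = (A (P v) : V) - (A' (P' v) : V) := fun v ↦ rfl
  have hPl : ∀ l : L, P l = l := fun l ↦ Submodule.projectionOnto_apply_left hLL' l
  have hPl' : ∀ l' : L', P l' = 0 := fun l' ↦ Submodule.projectionOnto_apply_right hLL' l'
  have hP'l : ∀ l : L, P' l = 0 := fun l ↦ Submodule.projectionOnto_apply_right hLL'.symm l
  have hP'l' : ∀ l' : L', P' l' = l' := fun l' ↦ Submodule.projectionOnto_apply_left hLL'.symm l'
  have hdec : ∀ v : V, ((P v : L) : V) + ((P' v : L') : V) = v := fun v ↦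
    Submodule.projection_add_projection_eq_self hLL' v
  have hyl : ∀ l : L, y l = A l := fun l ↦ by rw [hyapp, hPl, hP'l, map_zero, ZeroMemClass.coe_zero, sub_zero]
  have hyl' : ∀ l' : L', y l' = -(A' l' : V) := fun l' ↦ by
    rw [hyapp, hPl', hP'l', map_zero, ZeroMemClass.coe_zero, zero_sub]
  -- `y` is skew-adjoint
  have h11 : ∀ v w, B (A (P v) : V) (P w) = 0 := fun v w ↦ hL _ (A (P v)).2 _ (P w).2
  have h11' : ∀ v w, B (P v : V) (A (P w)) = 0 := fun v w ↦ hL _ (P v).2 _ (A (P w)).2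
  have h22 : ∀ v w, B (A' (P' v) : V) (P' w) = 0 := fun v w ↦ hL' _ (A' (P' v)).2 _ (P' w).2
  have h22' : ∀ v w, B (P' v : V) (A' (P' w)) = 0 := fun v w ↦ hL' _ (P' v).2 _ (A' (P' w)).2
  have key : ∀ v w, B (A (P v) : V) (P' w) = B (P v : V) (A' (P' w)) := fun v w ↦ by
    rw [hε (A (P v) : V), hε (P v : V), hA']
  have hymem : y ∈ skewAdjointLieSubalgebra B := by
    show y ∈ B.skewAdjointSubmodule
    rw [LinearMap.mem_skewAdjointSubmodule]
    intro v w
    rw [Pi.neg_apply]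
    conv_lhs => rw [← hdec v, ← hdec w]
    conv_rhs => rw [← hdec v, ← hdec w]
    simp only [map_add, map_neg, LinearMap.add_apply, LinearMap.neg_apply, hyl, hyl', h11, h11', h22, h22', key, hA']
    ring
  refine ⟨⟨y, hymem⟩, ?_, hyl⟩
  -- `y` commutes with `x`
  rw [mem_adDegree_zero_iff_commute]
  intro v
  change (x : Module.End K V) (y v) = y ((x : Module.End K V) v)
  conv_lhs => rw [← hdec v]
  conv_rhs => rw [← hdec v]
  rw [map_add, hyl, hyl', map_add, map_neg, hxL _ (A _).2, hxL' _ (A' _).2, map_add, hxL _ (P v).2, hxL' _ (P' v).2,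
    map_add, map_neg, hyl, hyl']

end Surjective

section Iso

variable [CharZero K] [FiniteDimensional K V]

/-- **"`𝔤_0` maps isomorphically to `𝔤𝔩(V_1)`"**: for `B` `ε`-symmetric, every `A ∈ 𝔤𝔩(L)` is the restriction of a
UNIQUE `y ∈ 𝔤_0`. [cite: LooijengaLunts1997, §2 (2.9) p. 10 L105–L110, p. 11 L1–L6] -/
theorem existsUnique_mem_adDegree_zero_restrict_eq (hB : B.Nondegenerate) {ε : K} (hε : ∀ u v, B u v = ε * B v u)
    (hLL' : IsCompl L L') (hL : ∀ u ∈ L, ∀ v ∈ L, B u v = 0) (hL' : ∀ u ∈ L', ∀ v ∈ L', B u v = 0)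
    (x : skewAdjointLieSubalgebra B) (hxL : ∀ v ∈ L, (x : Module.End K V) v = v)
    (hxL' : ∀ v ∈ L', (x : Module.End K V) v = -v) (A : L →ₗ[K] L) :
    ∃! y : skewAdjointLieSubalgebra B, y ∈ adDegree K x 0 ∧ ∀ v : L, (y : Module.End K V) v = A v := by
  obtain ⟨y, hy, hyA⟩ := exists_mem_adDegree_zero_restrict_eq hB hε hLL' hL hL' x hxL hxL' A
  refine ⟨y, ⟨hy, hyA⟩, fun y' ⟨hy', hy'A⟩ ↦ ?_⟩
  rw [← sub_eq_zero]
  refine eq_zero_of_mem_adDegree_zero_of_forall_left hB hLL' hL' x hxL hxL' (y' - y) (Submodule.sub_mem _ hy' hy)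
    fun v hv ↦ ?_
  rw [show ((y' - y : skewAdjointLieSubalgebra B) : Module.End K V) = (y' : Module.End K V) - y from rfl,
    LinearMap.sub_apply, sub_eq_zero]
  exact (hy'A ⟨v, hv⟩).trans (hyA ⟨v, hv⟩).symm

/-- Symplectic case `(C_m, A_{m-1})`: `𝔤_0 ≅ 𝔤𝔩(V_1)` for `B` alternating. [cite: LooijengaLunts1997, §2 (2.9) p. 10 L105–L110 ("Then 𝔤_0 maps isomorphically to 𝔤𝔩(V_1)")] -/
theorem existsUnique_mem_adDegree_zero_restrict_eq_of_isAlt (hB : B.Nondegenerate) (halt : B.IsAlt)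
    (hLL' : IsCompl L L') (hL : ∀ u ∈ L, ∀ v ∈ L, B u v = 0) (hL' : ∀ u ∈ L', ∀ v ∈ L', B u v = 0)
    (x : skewAdjointLieSubalgebra B) (hxL : ∀ v ∈ L, (x : Module.End K V) v = v)
    (hxL' : ∀ v ∈ L', (x : Module.End K V) v = -v) (A : L →ₗ[K] L) :
    ∃! y : skewAdjointLieSubalgebra B, y ∈ adDegree K x 0 ∧ ∀ v : L, (y : Module.End K V) v = A v :=
  existsUnique_mem_adDegree_zero_restrict_eq hB (ε := -1) (fun u v ↦ by rw [← halt.neg_eq, neg_one_mul]) hLL' hL hL'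
    x hxL hxL' A

/-- Orthogonal case `(D_{2m}, A_{2m-1})`: `𝔤_0 ≅ 𝔤𝔩(V_1)` for `B` symmetric. [cite: LooijengaLunts1997, §2 (2.9) p. 11 L1–L6 ("Then 𝔤_0 maps isomorphically to 𝔤𝔩(V_1)")] -/
theorem existsUnique_mem_adDegree_zero_restrict_eq_of_isSymm (hB : B.Nondegenerate)
    (hs : ∀ u v : V, B u v = B v u) (hLL' : IsCompl L L') (hL : ∀ u ∈ L, ∀ v ∈ L, B u v = 0)
    (hL' : ∀ u ∈ L', ∀ v ∈ L', B u v = 0) (x : skewAdjointLieSubalgebra B)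
    (hxL : ∀ v ∈ L, (x : Module.End K V) v = v) (hxL' : ∀ v ∈ L', (x : Module.End K V) v = -v) (A : L →ₗ[K] L) :
    ∃! y : skewAdjointLieSubalgebra B, y ∈ adDegree K x 0 ∧ ∀ v : L, (y : Module.End K V) v = A v :=
  existsUnique_mem_adDegree_zero_restrict_eq hB (ε := 1) (fun u v ↦ by rw [one_mul]; exact hs u v) hLL' hL hL' x hxL
    hxL' A

end Iso

end Literature.Algebra.Lie.LagrangianSplittingGrading
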